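import Summits.Parity.GeneralizedHardyLittlewood.Theses.LiouvilleShiftedTables
import Summits.Parity.GeneralizedHardyLittlewood.Theorems.TableChowla.Negative.TableChowlaBandReduction

/-!
# `TableChowla` (stmt-Parity-14270): column band domination and the short-sum sufficient condition

Support lemmas for the crux `LiouvilleShiftedTables.TableChowla` (cdisprove seat), dual to
`TableChowlaBandReduction` (van der Corput in the COLUMN variable):
* `vdC_momentN_cols` — `K·T ≤ (B + K − 1)·T_colband(K)` for every `K ≥ 1`, where
  `colBandMomentN … K` keeps only column pairs `b, b'` at distance `< K`, i.e. squares of the SHORT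
  sums `colCorr … b b' = Σ_{a ∈ (A,2A]} f(ab+c) f(ab'+c)`;
* `tableChowla_of_columnNearDiagonal` — `ColumnNearDiagonalChowla → TableChowla`: a
  `(log x)^{K−1}` mean-square saving in the binary correlations of the two linear forms
  `a ↦ b·a + c`, `a ↦ b'·a + c` over `a ∼ A` (length `x^δ … x^{5/12}`), on average over
  `b ≤ x/A` and `|b' − b| < (log x)^K`, for every `K`, proves the crux — the short-sum /
  large-average (Matomäki–Radziwiłł-shaped) sufficient condition. [folklore]
-/

namespace Summit.Parity.GeneralizedHardyLittlewood.Theorems.TableChowla.Negative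

open Finset Real ArithmeticFunction
open Summit.Parity.GeneralizedHardyLittlewood.Theses

noncomputable section

/-- Column correlation `G(b,b') = Σ_{a ∈ (A₁,A₂]} f(ab+c) f(ab'+c)` (a SHORT sum over the rows). -/
def colCorr (f : ℕ → ℝ) (c : ℤ) (A₁ A₂ b b' : ℕ) : ℝ :=
  ∑ a ∈ Ioc A₁ A₂, f (Int.toNat ((a : ℤ) * b + c)) * f (Int.toNat ((a : ℤ) * b' + c))

/-- COLUMN-BAND fourth moment: only column pairs at distance `< K` (diagonal included). -/
def colBandMomentN (f : ℕ → ℝ) (c : ℤ) (A₁ A₂ B K : ℕ) : ℝ :=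
  ∑ b ∈ Icc 1 B, ∑ b' ∈ (Icc 1 B).filter (fun b' => b' < b + K ∧ b < b' + K), colCorr f c A₁ A₂ b b' ^ 2

variable {f : ℕ → ℝ} {c : ℤ} {A₁ A₂ B : ℕ}

/-- **COLUMN BAND DOMINATION**: `K · T ≤ (B + K − 1) · T_colband(K)` for every `K ≥ 1`. -/
theorem vdC_momentN_cols {K : ℕ} (hK : 1 ≤ K) :
    (K : ℝ) * momentN f c A₁ A₂ B ≤ ((B + K - 1 : ℕ) : ℝ) * colBandMomentN f c A₁ A₂ B K := by
  set J : Finset ℕ := Icc 1 B with hJ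
  set M : Finset ℕ := Icc 1 (B + K - 1) with hM
  have hJM : ∀ b ∈ J, ∀ m, b ≤ m → m < b + K → m ∈ M := by
    intro b hb m h1 h2
    rw [hJ, mem_Icc] at hb
    rw [hM, mem_Icc]
    omega
  have hMcard : (M.card : ℝ) = ((B + K - 1 : ℕ) : ℝ) := by
    rw [hM, Nat.card_Icc, Nat.add_sub_cancel]
  set e : ℕ → ℕ → ℝ := fun a b => f (Int.toNat ((a : ℤ) * b + c)) with he
  set w : ℕ → ℕ → ℝ := fun b b' =>
    ((M.filter (fun m => (b ≤ m ∧ m < b + K) ∧ (b' ≤ m ∧ m < b' + K))).card : ℝ) with hw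
  -- Step 1: K² T ≤ |M| Σ_{b,b'} w(b,b') G(b,b')²
  have step1 : (K : ℝ) ^ 2 * momentN f c A₁ A₂ B ≤
      (M.card : ℝ) * ∑ b ∈ J, ∑ b' ∈ J, w b b' * colCorr f c A₁ A₂ b b' ^ 2 := by
    have hpt : ∀ a a' : ℕ, (K : ℝ) ^ 2 * (∑ b ∈ J, e a b * e a' b) ^ 2 ≤
        (M.card : ℝ) * ∑ b ∈ J, ∑ b' ∈ J, (e a b * e a' b) * (e a b' * e a' b') * w b b' :=
      fun a a' => vdC_pointwise (fun b => e a b * e a' b) hJM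
    unfold momentN rowCorr
    rw [← hJ, mul_sum]
    simp_rw [mul_sum (s := Ioc A₁ A₂) (a := (K : ℝ) ^ 2)]
    calc ∑ a ∈ Ioc A₁ A₂, ∑ a' ∈ Ioc A₁ A₂, (K : ℝ) ^ 2 * (∑ b ∈ J, e a b * e a' b) ^ 2
        ≤ ∑ a ∈ Ioc A₁ A₂, ∑ a' ∈ Ioc A₁ A₂,
            (M.card : ℝ) * ∑ b ∈ J, ∑ b' ∈ J, (e a b * e a' b) * (e a b' * e a' b') * w b b' :=
          sum_le_sum fun a _ => sum_le_sum fun a' _ => hpt a a'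
      _ = (M.card : ℝ) * ∑ b ∈ J, ∑ b' ∈ J, w b b' * colCorr f c A₁ A₂ b b' ^ 2 := by
          rw [mul_sum]
          simp_rw [mul_sum (a := (M.card : ℝ))]
          -- bubble the column sums (over J) outside the row sums (over Ioc A₁ A₂)
          simp_rw [sum_comm (s := Ioc A₁ A₂) (t := J)]
          refine sum_congr rfl fun b _ => sum_congr rfl fun b' _ => ?_
          simp_rw [← mul_sum]
          congr 1
          unfold colCorr
          rw [sq, sum_mul_sum, mul_sum]
          refine sum_congr rfl fun a _ => ?_
          rw [mul_sum]
          refine sum_congr rfl fun a' _ => ?_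
          simp only [he]
          ring
  -- Step 2: Σ_{b,b'} w G² ≤ K · T_colband(K)
  have step2 : ∑ b ∈ J, ∑ b' ∈ J, w b b' * colCorr f c A₁ A₂ b b' ^ 2 ≤
      (K : ℝ) * colBandMomentN f c A₁ A₂ B K := by
    unfold colBandMomentN
    rw [← hJ, mul_sum]
    refine sum_le_sum fun b hb => ?_
    rw [mul_sum, ← sum_filter_add_sum_filter_not J (fun b' => b' < b + K ∧ b < b' + K)]
    have hzero : ∑ b' ∈ J.filter (fun b' => ¬ (b' < b + K ∧ b < b' + K)),
        w b b' * colCorr f c A₁ A₂ b b' ^ 2 = 0 := by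
      refine sum_eq_zero fun b' hb' => ?_
      have hna := (mem_filter.mp hb').2
      simp only [hw, card_overlap_eq_zero hna, Nat.cast_zero, zero_mul]
    rw [hzero, add_zero]
    refine sum_le_sum fun b' _ => ?_
    have hwle : w b b' ≤ K := by
      simp only [hw]
      exact_mod_cast card_overlap_le (hJM b hb)
    exact mul_le_mul_of_nonneg_right hwle (sq_nonneg _)
  have hKpos : (0 : ℝ) < K := by exact_mod_cast hK
  have hcomb : (K : ℝ) ^ 2 * momentN f c A₁ A₂ B ≤ (K : ℝ) * (((B + K - 1 : ℕ) : ℝ) * colBandMomentN f c A₁ A₂ B K) := by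
    calc (K : ℝ) ^ 2 * momentN f c A₁ A₂ B
        ≤ (M.card : ℝ) * ∑ b ∈ J, ∑ b' ∈ J, w b b' * colCorr f c A₁ A₂ b b' ^ 2 := step1
      _ ≤ (M.card : ℝ) * ((K : ℝ) * colBandMomentN f c A₁ A₂ B K) :=
          mul_le_mul_of_nonneg_left step2 (Nat.cast_nonneg _)
      _ = (K : ℝ) * (((B + K - 1 : ℕ) : ℝ) * colBandMomentN f c A₁ A₂ B K) := by rw [hMcard]; ring
  rw [sq, mul_assoc] at hcomb
  exact le_of_mul_le_mul_left hcomb hKpos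

/-- COLUMN NEAR-DIAGONAL CHOWLA (short two-form sums, band of near-by columns, budget
`M·x·A·log x` — dual to `NearDiagonalChowla`'s `x² log x / A = x·B·log x`). -/
def ColumnNearDiagonalChowla : Prop :=
  ∀ c : ℤ, c ≠ 0 → ∀ δ : ℝ, 0 < δ → δ ≤ 1 / 12 → ∀ K : ℝ, 0 < K → ∃ x₀ : ℝ, ∀ x : ℝ, x₀ ≤ x →
    ∀ A : ℝ, x ^ δ ≤ A → A ≤ x ^ (1 / 3 + δ) →
      colBandMomentN lam c ⌊A⌋₊ ⌊2 * A⌋₊ ⌊x / A⌋₊ ⌊Real.log x ^ K⌋₊ ≤ x * A * Real.log x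

/-- **COLUMN BAND REDUCTION**: `ColumnNearDiagonalChowla → TableChowla` (take `K = C + 2`,
`Kn = ⌊(log x)^{C+2}⌋ ≤ B/2`; column band domination gives `T ≤ ((B + Kn)/Kn)·x A log x ≤
4x²/(log x)^{C+1}`). -/
theorem tableChowla_of_columnNearDiagonal (h : ColumnNearDiagonalChowla) :
    LiouvilleShiftedTables.TableChowla := by
  rw [tableChowla_iff]
  intro c hc δ hδ hδ' C hC
  obtain ⟨x₀, hx₀⟩ := h c hc δ hδ hδ' (C + 2) (by linarith)
  obtain ⟨X₁, hX₁⟩ := eventually_log_rpow_le hδ (C + 2)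
  refine ⟨max (max x₀ 4096) (max X₁ (Real.exp 8)), fun x hx A hA hA' => ?_⟩
  have hx₀x : x₀ ≤ x := le_trans (le_trans (le_max_left _ _) (le_max_left _ _)) hx
  have hx4096 : (4096 : ℝ) ≤ x := le_trans (le_trans (le_max_right _ _) (le_max_left _ _)) hx
  have hxX₁ : X₁ ≤ x := le_trans (le_trans (le_max_left _ _) (le_max_right _ _)) hx
  have hxe : Real.exp 8 ≤ x := le_trans (le_trans (le_max_right _ _) (le_max_right _ _)) hx
  have hx1 : (1 : ℝ) ≤ x := by linarith
  have hxpos : 0 < x := by linarith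
  have hlog8 : 8 ≤ Real.log x := (Real.le_log_iff_exp_le hxpos).mpr hxe
  have hlogpos : 0 < Real.log x := by linarith
  obtain ⟨h4, _⟩ := hX₁ x hxX₁
  have hAone : 1 ≤ A := le_trans (Real.one_le_rpow hx1 hδ.le) hA
  have hApos : 0 < A := by linarith
  -- Kr := (log x)^(C+2): 6 ≤ Kr ≤ x^δ/4 ≤ A/4, Kn := ⌊Kr⌋, Kn ≥ Kr/2
  set Kr : ℝ := Real.log x ^ (C + 2) with hKr
  have hKr8 : 8 ≤ Kr := by
    calc (8 : ℝ) ≤ Real.log x := hlog8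
      _ = Real.log x ^ (1 : ℝ) := (Real.rpow_one _).symm
      _ ≤ Kr := by rw [hKr]; exact Real.rpow_le_rpow_of_exponent_le (by linarith) (by linarith)
  set Kn : ℕ := ⌊Kr⌋₊ with hKndef
  have hKn1 : 1 ≤ Kn := by rw [hKndef, Nat.one_le_floor_iff]; linarith
  have hKnle : (Kn : ℝ) ≤ Kr := Nat.floor_le (by linarith)
  have hKnge : Kr / 2 ≤ Kn := by
    have := Nat.lt_floor_add_one Kr; rw [← hKndef] at this; linarith
  have hKnpos : (0 : ℝ) < Kn := by exact_mod_cast hKn1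
  -- B = ⌊x/A⌋ ≥ x^{7/12} - 1 ≥ ... we only need Kn ≤ B: Kr ≤ A/4?? no — need Kr ≤ B. B ≥ x/A - 1 ≥ x^{7/12} - 1.
  set Bn : ℕ := ⌊x / A⌋₊ with hBn
  have hBge : x / A - 1 < Bn := by have := Nat.lt_floor_add_one (x / A); rw [← hBn] at this; linarith
  have hxA : x ^ ((7 : ℝ) / 12) ≤ x / A := by
    rw [le_div_iff₀ hApos]
    calc x ^ ((7 : ℝ) / 12) * A ≤ x ^ ((7 : ℝ) / 12) * x ^ (1 / 3 + δ) :=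
          mul_le_mul_of_nonneg_left hA' (by positivity)
      _ = x ^ ((7 : ℝ) / 12 + (1 / 3 + δ)) := by rw [← Real.rpow_add hxpos]
      _ ≤ x ^ (1 : ℝ) := Real.rpow_le_rpow_of_exponent_le hx1 (by linarith)
      _ = x := Real.rpow_one x
  -- Kr ≤ x^δ/4 ≤ x^{7/12}/4 (δ ≤ 1/12 ≤ 7/12) and x^{7/12} ≥ 4096^{7/12} = 128 ⇒ Kr ≤ x^{7/12} - 1 - ... : Kn ≤ Kr ≤ (x/A) /4 ≤ Bn
  have hx712 : x ^ δ ≤ x ^ ((7 : ℝ) / 12) := Real.rpow_le_rpow_of_exponent_le hx1 (by linarith)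
  have h128 : (128 : ℝ) ≤ x ^ ((7 : ℝ) / 12) := by
    have e : ((2 : ℝ) ^ (12 : ℕ)) ^ ((7 : ℝ) / 12) = 2 ^ (7 : ℕ) := by
      rw [← Real.rpow_natCast (2 : ℝ) 12, ← Real.rpow_mul (by norm_num)]
      norm_num
    calc (128 : ℝ) = ((2 : ℝ) ^ (12 : ℕ)) ^ ((7 : ℝ) / 12) := by rw [e]; norm_num
      _ ≤ x ^ ((7 : ℝ) / 12) := Real.rpow_le_rpow (by norm_num) (by norm_num; linarith) (by norm_num)
  have hKrB : Kr ≤ (Bn : ℝ) / 2 := by nlinarith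
  have hband := hx₀ x hx₀x A hA hA'
  rw [← hKr, ← hKndef, ← hBn] at hband
  have hvdc := vdC_momentN_cols (f := lam) (c := c) (A₁ := ⌊A⌋₊) (A₂ := ⌊2 * A⌋₊) (B := Bn) hKn1
  have hcols : ((Bn + Kn - 1 : ℕ) : ℝ) ≤ 2 * Bn := by
    have h2 : ((Bn + Kn - 1 : ℕ) : ℝ) ≤ ((Bn + Kn : ℕ) : ℝ) := by exact_mod_cast Nat.sub_le _ _
    push_cast at h2
    linarith
  have hbandnn : 0 ≤ colBandMomentN lam c ⌊A⌋₊ ⌊2 * A⌋₊ Bn Kn :=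
    sum_nonneg fun _ _ => sum_nonneg fun _ _ => sq_nonneg _
  have hBle : (Bn : ℝ) ≤ x / A := Nat.floor_le (by positivity)
  -- Kn T ≤ 2 Bn · x A log x ≤ 2 (x/A) x A log x = 2 x² log x
  have hKT : (Kn : ℝ) * momentN lam c ⌊A⌋₊ ⌊2 * A⌋₊ Bn ≤ 2 * x ^ 2 * Real.log x := by
    calc (Kn : ℝ) * momentN lam c ⌊A⌋₊ ⌊2 * A⌋₊ Bn
        ≤ ((Bn + Kn - 1 : ℕ) : ℝ) * colBandMomentN lam c ⌊A⌋₊ ⌊2 * A⌋₊ Bn Kn := hvdc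
      _ ≤ (2 * Bn) * (x * A * Real.log x) := mul_le_mul hcols hband hbandnn (by positivity)
      _ ≤ (2 * (x / A)) * (x * A * Real.log x) :=
          mul_le_mul_of_nonneg_right (by linarith) (by positivity)
      _ = 2 * x ^ 2 * Real.log x := by field_simp
  -- T ≤ 2x² log x / Kn ≤ 4 x² log x / Kr = 4x²/(log x)^{C+1} ≤ x²/(log x)^C  (log x ≥ 8 ≥ 4)
  have hsplit : Kr = Real.log x ^ C * Real.log x ^ 2 := by
    rw [hKr, Real.rpow_add hlogpos, Real.rpow_two]
  show momentN lam c ⌊A⌋₊ ⌊2 * A⌋₊ ⌊x / A⌋₊ ≤ x ^ 2 / Real.log x ^ C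
  rw [← hBn]
  have hLpos : 0 < Real.log x ^ C := Real.rpow_pos_of_pos hlogpos C
  rw [le_div_iff₀ hLpos]
  have hT0 : 0 ≤ momentN lam c ⌊A⌋₊ ⌊2 * A⌋₊ Bn := momentN_nonneg
  have h1 : Kr * momentN lam c ⌊A⌋₊ ⌊2 * A⌋₊ Bn ≤ 4 * x ^ 2 * Real.log x := by
    nlinarith [mul_le_mul_of_nonneg_right hKnge hT0]
  rw [hsplit] at h1
  have hl2 : 0 < Real.log x ^ 2 := by positivity
  have h2 : momentN lam c ⌊A⌋₊ ⌊2 * A⌋₊ Bn * Real.log x ^ C * Real.log x ^ 2 ≤ x ^ 2 * Real.log x ^ 2 := by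
    have hx2l : (0 : ℝ) ≤ x ^ 2 * Real.log x := by positivity
    calc momentN lam c ⌊A⌋₊ ⌊2 * A⌋₊ Bn * Real.log x ^ C * Real.log x ^ 2
        = Real.log x ^ C * Real.log x ^ 2 * momentN lam c ⌊A⌋₊ ⌊2 * A⌋₊ Bn := by ring
      _ ≤ 4 * x ^ 2 * Real.log x := h1
      _ = 4 * (x ^ 2 * Real.log x) := by ring
      _ ≤ Real.log x * (x ^ 2 * Real.log x) := mul_le_mul_of_nonneg_right (by linarith) hx2l
      _ = x ^ 2 * Real.log x ^ 2 := by ring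
  exact le_of_mul_le_mul_right h2 hl2

end

end Summit.Parity.GeneralizedHardyLittlewood.Theorems.TableChowla.Negative
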